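import Mathlib.Analysis.SpecialFunctions.Pow.Real
import Mathlib.Analysis.Complex.Basic
import HarnessLib

/-!
# E-CANARY-128 — D3 file 4/8: the interval kernel (dyadic intervals on `ℤ` mantissas) and its soundness

RH-FREE, generic (no `ξ` here). Binary floating/fixed-point interval arithmetic in the shape measured by the D1
rehearsal (`HOME/rh-jensen/eng/g8/canary/proto/CanaryCheckProto.lean`): a real interval is `[lo, hi]·2^e`
(`FI`), a complex box is `([rlo,rhi] + i[ilo,ihi])·2^e` (`CI`); outward rounding is done ONLY by the floor/ceil
primitives `shrFloor/shrCeil` (arithmetic shift, `Int.shiftRight_eq_div_pow`) and `divFloor/divCeil`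
(Euclidean division), whose soundness is `Int.ediv_mul_le` / `Int.lt_ediv_add_one_mul_self`. Every operation
comes with its inclusion lemma (`…_mem`), pattern of the tree's `JensenPolynomialsXiGorttwCoeffSmallTableCheck`
(Moore's inclusion monotonicity). Used by `…CanarySeries` (enclosures of the finite sums of the contract
`Canary.PieceIneq`) and evaluated by `native_decide` in `…CanaryCert`. Nothing here bears on the truth of RH.
-/

-- D-0017: the doubled namespace is by design.
set_option linter.dupNamespace false
set_option autoImplicit false

namespace Summit.RiemannHypothesis.RiemannHypothesis.Theorems.JensenPolynomials.LogBand.Canary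

/-! ## Dyadic values `m · 2^e` -/

/-- The real number `m · 2^e` denoted by a mantissa/exponent pair. -/
noncomputable def dy (m e : ℤ) : ℝ := (m : ℝ) * (2 : ℝ) ^ e

/-- Monotonicity in the mantissa. -/
theorem dy_mono {m m' : ℤ} (e : ℤ) (h : m ≤ m') : dy m e ≤ dy m' e := by
  unfold dy
  exact mul_le_mul_of_nonneg_right (by exact_mod_cast h) ((zpow_pos (by norm_num : (0:ℝ) < 2) e)).le

/-- Additivity in the mantissa. -/
theorem dy_add (m m' e : ℤ) : dy (m + m') e = dy m e + dy m' e := by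
  unfold dy; push_cast; ring

/-- Negation. -/
theorem dy_neg (m e : ℤ) : dy (-m) e = -dy m e := by
  unfold dy; push_cast; ring

/-- `dy 0 e = 0`. -/
@[simp] theorem dy_zero (e : ℤ) : dy 0 e = 0 := by simp [dy]

/-- Products multiply mantissas and add exponents. -/
theorem dy_mul (m m' e e' : ℤ) : dy m e * dy m' e' = dy (m * m') (e + e') := by
  unfold dy
  rw [zpow_add₀ (by norm_num : (2 : ℝ) ≠ 0)]
  push_cast; ring

/-- Moving a power of two from the mantissa to the exponent. -/
theorem dy_shift (m e : ℤ) (s : ℕ) : dy (m * 2 ^ s) e = dy m (e + s) := by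
  unfold dy
  rw [zpow_add₀ (by norm_num : (2 : ℝ) ≠ 0), zpow_natCast]
  push_cast; ring

/-- Multiplying the mantissa by an integer. -/
theorem dy_mul_int (m e q : ℤ) : dy m e * (q : ℝ) = dy (m * q) e := by
  unfold dy; push_cast; ring

/-- Sign of a dyadic value. -/
theorem dy_nonneg {m : ℤ} (e : ℤ) (h : 0 ≤ m) : 0 ≤ dy m e := by
  unfold dy; exact mul_nonneg (by exact_mod_cast h) ((zpow_pos (by norm_num : (0:ℝ) < 2) e)).le

/-! ## Rounding primitives -/

/-- Arithmetic right shift = floor division by `2^s`. -/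
def shrFloor (a : ℤ) (s : ℕ) : ℤ := a >>> s

/-- Ceiling division by `2^s`. -/
def shrCeil (a : ℤ) (s : ℕ) : ℤ := -((-a) >>> s)

/-- Floor division by a positive natural. -/
def divFloor (a : ℤ) (q : ℕ) : ℤ := a / (q : ℤ)

/-- Ceiling division by a positive natural. -/
def divCeil (a : ℤ) (q : ℕ) : ℤ := -((-a) / (q : ℤ))

/-- `⌊a/2^s⌋·2^s ≤ a`. -/
theorem shrFloor_mul_le (a : ℤ) (s : ℕ) : shrFloor a s * 2 ^ s ≤ a := by
  unfold shrFloor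
  rw [Int.shiftRight_eq_div_pow]
  have h := Int.ediv_mul_le a (b := ((2 ^ s : ℕ) : ℤ)) (by positivity)
  simpa using h

/-- `a ≤ ⌈a/2^s⌉·2^s`. -/
theorem le_shrCeil_mul (a : ℤ) (s : ℕ) : a ≤ shrCeil a s * 2 ^ s := by
  unfold shrCeil
  have h := shrFloor_mul_le (-a) s
  unfold shrFloor at h
  linarith

/-- `⌊a/q⌋·q ≤ a` (`q > 0`). -/
theorem divFloor_mul_le (a : ℤ) {q : ℕ} (hq : 0 < q) : divFloor a q * q ≤ a := by
  unfold divFloor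
  exact Int.ediv_mul_le a (by exact_mod_cast hq.ne')

/-- `a ≤ ⌈a/q⌉·q` (`q > 0`). -/
theorem le_divCeil_mul (a : ℤ) {q : ℕ} (hq : 0 < q) : a ≤ divCeil a q * q := by
  unfold divCeil
  have h := Int.ediv_mul_le (-a) (b := (q : ℤ)) (by exact_mod_cast hq.ne')
  linarith

/-- Shifting right and bumping the exponent rounds DOWN. -/
theorem dy_shrFloor_le (a e : ℤ) (s : ℕ) : dy (shrFloor a s) (e + s) ≤ dy a e := by
  rw [← dy_shift]
  exact dy_mono e (shrFloor_mul_le a s)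

/-- Shifting right and bumping the exponent rounds UP. -/
theorem dy_le_shrCeil (a e : ℤ) (s : ℕ) : dy a e ≤ dy (shrCeil a s) (e + s) := by
  rw [← dy_shift]
  exact dy_mono e (le_shrCeil_mul a s)

/-! ## Real dyadic intervals -/

/-- A real interval `[lo, hi]·2^e`. -/
structure FI where
  /-- lower mantissa -/
  lo : ℤ
  /-- upper mantissa -/
  hi : ℤ
  /-- binary exponent -/
  e : ℤ
deriving Repr, Inhabited, DecidableEq

/-- `r ∈ [lo, hi]·2^e`. -/
def FI.Mem (r : ℝ) (x : FI) : Prop := dy x.lo x.e ≤ r ∧ r ≤ dy x.hi x.e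

/-- Bit length of `|a|` (`0 ↦ 0`). -/
def bitlen (a : ℤ) : ℕ := if a = 0 then 0 else Nat.log2 a.natAbs + 1

/-- Normalise to at most `P + 1` mantissa bits (outward). -/
def FI.norm (P : ℕ) (x : FI) : FI :=
  let b := max (bitlen x.lo) (bitlen x.hi)
  if b ≤ P + 1 then x else
    let s := b - P
    ⟨shrFloor x.lo s, shrCeil x.hi s, x.e + s⟩

/-- Normalisation preserves membership. -/
theorem FI.norm_mem {r : ℝ} {x : FI} (P : ℕ) (h : FI.Mem r x) : FI.Mem r (FI.norm P x) := by
  unfold FI.norm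
  dsimp only
  split_ifs with hb
  · exact h
  · exact ⟨(dy_shrFloor_le _ _ _).trans h.1, h.2.trans (dy_le_shrCeil _ _ _)⟩

/-- A nonnegative lower mantissa survives normalisation. -/
theorem FI.norm_lo_nonneg {x : FI} (P : ℕ) (h : 0 ≤ x.lo) : 0 ≤ (FI.norm P x).lo := by
  unfold FI.norm
  dsimp only
  split_ifs with hb
  · exact h
  · show 0 ≤ shrFloor x.lo _
    unfold shrFloor
    rw [Int.shiftRight_eq_div_pow]
    exact Int.ediv_nonneg h (by positivity)

/-- Product of two intervals with nonnegative lower mantissas. -/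
def FI.mulPos (P : ℕ) (x y : FI) : FI := FI.norm P ⟨x.lo * y.lo, x.hi * y.hi, x.e + y.e⟩

/-- The product encloses the product. -/
theorem FI.mulPos_mem {r s : ℝ} {x y : FI} (P : ℕ) (hx0 : 0 ≤ x.lo) (hy0 : 0 ≤ y.lo)
    (hr : FI.Mem r x) (hs : FI.Mem s y) : FI.Mem (r * s) (FI.mulPos P x y) := by
  apply FI.norm_mem
  have hr0 : 0 ≤ r := (dy_nonneg x.e hx0).trans hr.1
  have hxlo : 0 ≤ dy x.lo x.e := dy_nonneg x.e hx0
  have hylo : 0 ≤ dy y.lo y.e := dy_nonneg y.e hy0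
  constructor
  · show dy (x.lo * y.lo) (x.e + y.e) ≤ r * s
    rw [← dy_mul]
    exact mul_le_mul hr.1 hs.1 hylo hr0
  · show r * s ≤ dy (x.hi * y.hi) (x.e + y.e)
    rw [← dy_mul]
    exact mul_le_mul hr.2 hs.2 (hylo.trans hs.1) (hxlo.trans hr.1 |>.trans hr.2)

/-- The lower mantissa of `mulPos` is nonnegative. -/
theorem FI.mulPos_lo_nonneg {x y : FI} (P : ℕ) (hx0 : 0 ≤ x.lo) (hy0 : 0 ≤ y.lo) :
    0 ≤ (FI.mulPos P x y).lo :=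
  FI.norm_lo_nonneg P (mul_nonneg hx0 hy0)

/-! ## Complex dyadic boxes -/

/-- A complex box `([rlo,rhi] + i·[ilo,ihi])·2^e`. -/
structure CI where
  /-- lower real mantissa -/
  rlo : ℤ
  /-- upper real mantissa -/
  rhi : ℤ
  /-- lower imaginary mantissa -/
  ilo : ℤ
  /-- upper imaginary mantissa -/
  ihi : ℤ
  /-- binary exponent -/
  e : ℤ
deriving Repr, Inhabited, DecidableEq

/-- `w ∈ box`. -/
def CI.Mem (w : ℂ) (x : CI) : Prop :=
  dy x.rlo x.e ≤ w.re ∧ w.re ≤ dy x.rhi x.e ∧ dy x.ilo x.e ≤ w.im ∧ w.im ≤ dy x.ihi x.e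

/-- Normalise to at most `P + 1` mantissa bits (outward). -/
def CI.norm (P : ℕ) (x : CI) : CI :=
  let b := max (max (bitlen x.rlo) (bitlen x.rhi)) (max (bitlen x.ilo) (bitlen x.ihi))
  if b ≤ P + 1 then x else
    let s := b - P
    ⟨shrFloor x.rlo s, shrCeil x.rhi s, shrFloor x.ilo s, shrCeil x.ihi s, x.e + s⟩

/-- Normalisation preserves membership. -/
theorem CI.norm_mem {w : ℂ} {x : CI} (P : ℕ) (h : CI.Mem w x) : CI.Mem w (CI.norm P x) := by
  unfold CI.norm
  dsimp only
  split_ifs with hb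
  · exact h
  · exact ⟨(dy_shrFloor_le _ _ _).trans h.1, h.2.1.trans (dy_le_shrCeil _ _ _),
      (dy_shrFloor_le _ _ _).trans h.2.2.1, h.2.2.2.trans (dy_le_shrCeil _ _ _)⟩

/-- Outward rounding of the EXACT Gaussian rational `(A + B·i)/Q` (`Q > 0`) with `T` fractional bits. -/
def CI.ofExact (P T : ℕ) (A B : ℤ) (Q : ℕ) : CI :=
  CI.norm P ⟨divFloor (A * 2 ^ T) Q, divCeil (A * 2 ^ T) Q, divFloor (B * 2 ^ T) Q, divCeil (B * 2 ^ T) Q, -(T : ℤ)⟩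

/-- One component of `CI.ofExact`: `⌊A·2^T/Q⌋·2^{−T} ≤ A/Q ≤ ⌈A·2^T/Q⌉·2^{−T}`. -/
theorem divFloor_dy_le_div (T : ℕ) (A : ℤ) {Q : ℕ} (hQ : 0 < Q) :
    dy (divFloor (A * 2 ^ T) Q) (-(T : ℤ)) ≤ (A : ℝ) / (Q : ℝ) ∧
      (A : ℝ) / (Q : ℝ) ≤ dy (divCeil (A * 2 ^ T) Q) (-(T : ℤ)) := by
  have hQr : (0 : ℝ) < (Q : ℝ) := by exact_mod_cast hQ
  have e1 : (A : ℝ) / (Q : ℝ) = dy (A * 2 ^ T) (-(T : ℤ)) / (Q : ℝ) := by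
    rw [dy_shift]; simp [dy]
  constructor
  · rw [e1, le_div_iff₀ hQr]
    have hz := divFloor_mul_le (A * 2 ^ T) hQ
    have h' : dy (divFloor (A * 2 ^ T) Q * (Q : ℤ)) (-(T : ℤ)) ≤ dy (A * 2 ^ T) (-(T : ℤ)) := dy_mono _ hz
    have hc : ((Q : ℤ) : ℝ) = (Q : ℝ) := by push_cast; rfl
    rw [← hc, dy_mul_int]; exact h'
  · rw [e1, div_le_iff₀ hQr]
    have hz := le_divCeil_mul (A * 2 ^ T) hQ
    have h' : dy (A * 2 ^ T) (-(T : ℤ)) ≤ dy (divCeil (A * 2 ^ T) Q * (Q : ℤ)) (-(T : ℤ)) := dy_mono _ hz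
    have hc : ((Q : ℤ) : ℝ) = (Q : ℝ) := by push_cast; rfl
    rw [← hc, dy_mul_int]; exact h'

/-- `CI.ofExact` encloses `(A + B·i)/Q`. -/
theorem CI.ofExact_mem (P T : ℕ) (A B : ℤ) {Q : ℕ} (hQ : 0 < Q) :
    CI.Mem (((A : ℂ) + (B : ℂ) * Complex.I) / (Q : ℂ)) (CI.ofExact P T A B Q) := by
  apply CI.norm_mem
  have hre : ((((A : ℂ) + (B : ℂ) * Complex.I) / (Q : ℂ))).re = (A : ℝ) / (Q : ℝ) := by
    simp [Complex.div_re, Complex.normSq]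
    have hQr : (Q : ℝ) ≠ 0 := by exact_mod_cast hQ.ne'
    field_simp
  have him : ((((A : ℂ) + (B : ℂ) * Complex.I) / (Q : ℂ))).im = (B : ℝ) / (Q : ℝ) := by
    simp [Complex.div_im, Complex.normSq]
    have hQr : (Q : ℝ) ≠ 0 := by exact_mod_cast hQ.ne'
    field_simp
  refine ⟨?_, ?_, ?_, ?_⟩
  · rw [hre]; exact (divFloor_dy_le_div T A hQ).1
  · rw [hre]; exact (divFloor_dy_le_div T A hQ).2
  · rw [him]; exact (divFloor_dy_le_div T B hQ).1
  · rw [him]; exact (divFloor_dy_le_div T B hQ).2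

/-- Nonnegative real interval times complex box (exact mantissa products, exponents added). -/
def CI.mulFIpos (r : FI) (x : CI) : CI :=
  ⟨if 0 ≤ x.rlo then r.lo * x.rlo else r.hi * x.rlo,
   if 0 ≤ x.rhi then r.hi * x.rhi else r.lo * x.rhi,
   if 0 ≤ x.ilo then r.lo * x.ilo else r.hi * x.ilo,
   if 0 ≤ x.ihi then r.hi * x.ihi else r.lo * x.ihi,
   r.e + x.e⟩

/-- One-dimensional core of `mulFIpos`: for `0 ≤ ρ₁·2^e ≤ ρ ≤ ρ₂·2^e` and `w₁·2^f ≤ w ≤ w₂·2^f`,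
the sign-split endpoint products enclose `ρ·w`. -/
theorem mul_mem_signsplit {ρ w : ℝ} {l1 h1 l2 h2 e f : ℤ} (h0 : 0 ≤ l1)
    (hρ : dy l1 e ≤ ρ ∧ ρ ≤ dy h1 e) (hw : dy l2 f ≤ w ∧ w ≤ dy h2 f) :
    dy (if 0 ≤ l2 then l1 * l2 else h1 * l2) (e + f) ≤ ρ * w ∧
      ρ * w ≤ dy (if 0 ≤ h2 then h1 * h2 else l1 * h2) (e + f) := by
  have hρ0 : 0 ≤ ρ := (dy_nonneg e h0).trans hρ.1
  constructor
  · split_ifs with hl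
    · rw [← dy_mul]
      exact mul_le_mul hρ.1 hw.1 (dy_nonneg f hl) hρ0
    · rw [← dy_mul]
      have hl' : dy l2 f ≤ 0 := by
        have : l2 ≤ 0 := (not_le.mp hl).le
        have := dy_mono f this; simpa using this
      calc dy h1 e * dy l2 f ≤ ρ * dy l2 f := mul_le_mul_of_nonpos_right hρ.2 hl'
        _ ≤ ρ * w := mul_le_mul_of_nonneg_left hw.1 hρ0
  · split_ifs with hh
    · rw [← dy_mul]
      have hh1 : 0 ≤ dy h1 e := hρ0.trans hρ.2
      have hh2 : 0 ≤ dy h2 f := dy_nonneg f hh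
      rcases le_or_gt 0 w with hw0 | hw0
      · exact mul_le_mul hρ.2 hw.2 hw0 hh1
      · calc ρ * w ≤ 0 := by nlinarith
          _ ≤ dy h1 e * dy h2 f := mul_nonneg hh1 hh2
    · rw [← dy_mul]
      have hh' : dy h2 f ≤ 0 := by
        have : h2 ≤ 0 := (not_le.mp hh).le
        have := dy_mono f this; simpa using this
      have hw0 : w ≤ 0 := hw.2.trans hh'
      calc ρ * w ≤ ρ * dy h2 f := mul_le_mul_of_nonneg_left hw.2 hρ0
        _ ≤ dy l1 e * dy h2 f := mul_le_mul_of_nonpos_right hρ.1 hh'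

/-- `mulFIpos` encloses `ρ · w` for `ρ` in a nonnegative real interval and `w` in a complex box. -/
theorem CI.mulFIpos_mem {ρ : ℝ} {w : ℂ} {r : FI} {x : CI} (h0 : 0 ≤ r.lo) (hρ : FI.Mem ρ r) (hw : CI.Mem w x) :
    CI.Mem ((ρ : ℂ) * w) (CI.mulFIpos r x) := by
  have hre : (((ρ : ℂ) * w)).re = ρ * w.re := by simp
  have him : (((ρ : ℂ) * w)).im = ρ * w.im := by simp
  unfold CI.mulFIpos CI.Mem
  dsimp only
  rw [hre, him]
  have h1 := mul_mem_signsplit h0 hρ ⟨hw.1, hw.2.1⟩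
  have h2 := mul_mem_signsplit h0 hρ ⟨hw.2.2.1, hw.2.2.2⟩
  exact ⟨h1.1, h1.2, h2.1, h2.2⟩

/-! ## Moving to a fixed accumulator unit `2^U` -/

/-- `v·2^e` rounded DOWN to an integer multiple of `2^U`. -/
def toUnitFloor (v e U : ℤ) : ℤ :=
  if U ≤ e then v * 2 ^ (e - U).toNat else shrFloor v (U - e).toNat

/-- `v·2^e` rounded UP to an integer multiple of `2^U`. -/
def toUnitCeil (v e U : ℤ) : ℤ :=
  if U ≤ e then v * 2 ^ (e - U).toNat else shrCeil v (U - e).toNat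

/-- `toUnitFloor` rounds down. -/
theorem dy_toUnitFloor_le (v e U : ℤ) : dy (toUnitFloor v e U) U ≤ dy v e := by
  unfold toUnitFloor
  split_ifs with h
  · rw [dy_shift]
    have : U + ((e - U).toNat : ℕ) = e := by omega
    rw [this]
  · have hs : e + ((U - e).toNat : ℕ) = U := by omega
    have := dy_shrFloor_le v e (U - e).toNat
    rwa [hs] at this

/-- `toUnitCeil` rounds up. -/
theorem dy_le_toUnitCeil (v e U : ℤ) : dy v e ≤ dy (toUnitCeil v e U) U := by
  unfold toUnitCeil
  split_ifs with h
  · rw [dy_shift]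
    have : U + ((e - U).toNat : ℕ) = e := by omega
    rw [this]
  · have hs : e + ((U - e).toNat : ℕ) = U := by omega
    have := dy_le_shrCeil v e (U - e).toNat
    rwa [hs] at this

/-! ## Modulus bound from a box at unit `2^U` -/

/-- If `|Re w| ≤ A·2^U` and `|Im w| ≤ B·2^U` then `‖w‖ ≤ (Nat.sqrt (A²+B²) + 1)·2^U`. -/
theorem norm_le_of_abs_re_im_le {w : ℂ} {A B : ℕ} {U : ℤ}
    (hre : |w.re| ≤ dy A U) (him : |w.im| ≤ dy B U) :
    ‖w‖ ≤ dy ((Nat.sqrt (A * A + B * B) + 1 : ℕ) : ℤ) U := by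
  set s := Nat.sqrt (A * A + B * B) with hs
  have hsq : (A : ℝ) * A + B * B ≤ ((s + 1 : ℕ) : ℝ) * ((s + 1 : ℕ) : ℝ) := by
    have := Nat.lt_succ_sqrt (A * A + B * B)
    exact_mod_cast this.le
  have hp : (0 : ℝ) < (2 : ℝ) ^ U := (zpow_pos (by norm_num : (0:ℝ) < 2) U)
  have hA : (0 : ℝ) ≤ (A : ℝ) := by positivity
  have hB : (0 : ℝ) ≤ (B : ℝ) := by positivity
  have h1 : w.re ^ 2 ≤ ((A : ℝ) * (2 : ℝ) ^ U) ^ 2 := by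
    have := hre; unfold dy at this; push_cast at this
    exact sq_le_sq' (by linarith [abs_le.mp this |>.1]) (abs_le.mp this).2
  have h2 : w.im ^ 2 ≤ ((B : ℝ) * (2 : ℝ) ^ U) ^ 2 := by
    have := him; unfold dy at this; push_cast at this
    exact sq_le_sq' (by linarith [abs_le.mp this |>.1]) (abs_le.mp this).2
  have hn : ‖w‖ ^ 2 = w.re ^ 2 + w.im ^ 2 := by
    rw [Complex.sq_norm, Complex.normSq_apply]; ring
  have hbound : ‖w‖ ^ 2 ≤ (dy ((s + 1 : ℕ) : ℤ) U) ^ 2 := by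
    rw [hn]
    have hcast : dy ((s + 1 : ℕ) : ℤ) U = ((s + 1 : ℕ) : ℝ) * (2 : ℝ) ^ U := by
      unfold dy; push_cast; ring
    rw [hcast]
    calc w.re ^ 2 + w.im ^ 2 ≤ ((A : ℝ) * (2 : ℝ) ^ U) ^ 2 + ((B : ℝ) * (2 : ℝ) ^ U) ^ 2 := add_le_add h1 h2
      _ = ((A : ℝ) * A + B * B) * ((2 : ℝ) ^ U) ^ 2 := by ring
      _ ≤ (((s + 1 : ℕ) : ℝ) * ((s + 1 : ℕ) : ℝ)) * ((2 : ℝ) ^ U) ^ 2 :=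
          mul_le_mul_of_nonneg_right hsq (sq_nonneg _)
      _ = (((s + 1 : ℕ) : ℝ) * (2 : ℝ) ^ U) ^ 2 := by ring
  have hd0 : 0 ≤ dy ((s + 1 : ℕ) : ℤ) U := dy_nonneg U (by positivity)
  exact (abs_le_of_sq_le_sq' hbound hd0).2

end Summit.RiemannHypothesis.RiemannHypothesis.Theorems.JensenPolynomials.LogBand.Canary
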